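import Literature.AnabelianGeometry.SemiGraphs.TemperedHostEdgeEndsOfTopCyclic
import Literature.AnabelianGeometry.SemiGraphs.TemperedCompactInVerticialAtOfNoEscape
import Literature.AnabelianGeometry.SemiGraphs.TemperedPiDecompositionEdgesStab
import HarnessLib

/-!
# [SemiAnbd] Thm 3.7 (iii), second sentence, on EVERY graph of anabelioids with TOPOLOGICALLY CYCLIC edge
# groups: two fixed vertex systems are equal or adjacent (`hbdd` / `hadj` hypothesis-free; proof-only)

Mochizuki, *Semi-graphs of anabelioids*, Publ. RIMS **42** (2006), §3 Theorem 3.7 (iii), proof p. 41,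
third paragraph ("if `H` fixes two vertices of `𝒢_{∞,j}`, then these two vertices are joined to one another
by a single edge"), with the author's *Comments* (2020) (6)(b) [cite: MochizukiSemiAnbd2006, Thm 3.7(iii) p.41].

PROOF-ONLY (cell abc-iut, block F, seat abc-iut-f-172 gen 7; row «HBDD@TOP-CYCLIC», sequel of
«(R3c)@TOP-CYCLIC-CORE»; no definition, no named fact).  At the canonical tower of a countable `𝒢`
satisfying the hypotheses of Thm. 3.7, ALL of whose edge groups are topologically cyclic — NO hypothesis on
the underlying semi-graph (cycles, loops, vertices of infinite valence, infinitely-branching cores) — and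
WITHOUT any host hypothesis:
* `dist_le_four_of_fixed_of_topCyclic` — ANY two compatible vertex systems `x`, `x'` fixed by a subgroup
  `C ≠ 1` are, at every level, equal or the two ends of one edge (subdivision distance `≤ 4`).  The host edge
  system of the prequel is BUILT: the first branches `β_n` of the level geodesics `[x_n, x'_n]` reappear,
  `C`-fixed, at `x_N` for all `N ≥ n` (`exists_fixed_branch_at_host_of_firstBranch`), hence lie over ONE
  base branch (abc-iut-w6-d062's `eventually_not_fixed_pair_of_ne_base_pair`) and are COMPATIBLE
  (`eventually_fold_same_base_pair`, then functoriality); abc-iut-L3-t6's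
  `exists_edgeSeq_edge_eq_eventual` turns them into an edge-point sequence `Q`, and the prequel's
  two-point locus `dist_le_four_of_fixed_pair` applies.
* `hbdd_temperedPiChart_of_topCyclic`, `hadj_temperedPiChart_of_topCyclic` — the binders `hbdd` (bound
  `4`) and (FIX∞).`hadj` in the shapes of abc-iut-f-176's `…_of_noCore` versions (the latter via
  abc-iut-L3-t10's `hadj_temperedPiChart_of_bounded_dist'`), for every compact `C ≠ 1`.
* `centralizer_le_verticial_of_compact_of_topCyclic` — the centraliser of EVERY compact `C ≠ 1` lies in
  each verticial subgroup containing `C` (abc-iut-f-172 gen 4's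
  `mem_verticial_of_centralizer_of_bounded_displacement`); host-free form of the prequel's
  `centralizer_le_verticial_of_topCyclic`.

Honest framing: one instance class; the ∀-closures F-2773 / F-1732 are NOT claimed; nothing here bears on
[IUTchIII] Cor. 3.12; typed ≠ proved elsewhere.
-/

namespace Literature.AnabelianGeometry.SemiGraphs

namespace ProfiniteSemiGraph

open CategoryTheory Topology

universe u

namespace GaloisLevelData

variable {𝒢 : ProfiniteSemiGraph.{u}} (D : GaloisLevelData 𝒢) (h𝒢 : 𝒢.IsCountable)

/-- Equivariance of the tree transitions on edges, pointwise. [cite: MochizukiSemiAnbd2006, Thm 3.7(iii) p.41] -/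
theorem treeTrans_act_edgeMap {i j : ℕ} (h : i ≤ j) (g : D.temperedPi h𝒢) (x : (D.tree j).Edge) :
    (D.treeTrans h).edgeMap ((D.treeAct h𝒢 j g).hom.edgeMap x) =
      (D.treeAct h𝒢 i g).hom.edgeMap ((D.treeTrans h).edgeMap x) := by
  have e := congrArg (fun φ => SemiGraph.Hom.edgeMap φ x) (D.treeTrans_act h𝒢 h g)
  simpa only [SemiGraph.comp_edgeMap, Function.comp_apply] using e

/-- Transition maps compose on branches, pointwise. [cite: MochizukiSemiAnbd2006, Thm 3.7(iii) p.41] -/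
theorem treeTrans_branchMap_comp {i j k : ℕ} (hij : i ≤ j) (hjk : j ≤ k) (b : (D.tree k).Branch) :
    (D.treeTrans hij).branchMap ((D.treeTrans hjk).branchMap b) = (D.treeTrans (hij.trans hjk)).branchMap b := by
  have e := congrArg (fun φ => SemiGraph.Hom.branchMap φ b) (D.treeTrans_comp hij hjk)
  simpa only [SemiGraph.comp_branchMap, Function.comp_apply] using e

end GaloisLevelData

variable (𝒢 : ProfiniteSemiGraph.{u}) (h37 : 𝒢.Thm37Hypotheses)

/-- **`hbdd` with bound `4`, HYPOTHESIS-FREE on the class «all edge groups topologically cyclic»** (any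
underlying graph).  At the canonical tower, any two compatible vertex systems fixed by a subgroup `C ≠ 1` are
at every level equal or the two ends of one edge.  (The first branches of the level geodesics `[x_n, x'_n]`
form — by transport to the host, estrangement in depth and the same-branch fold — a compatible `C`-fixed
edge system with `x` as an end; it is the edge system of an edge-point sequence, and the two-point fixed
locus of the prequel applies.) [cite: MochizukiSemiAnbd2006, Thm 3.7(iii) p.41] -/
theorem dist_le_four_of_fixed_of_topCyclic
    (hcyc : ∀ e : 𝒢.graph.Edge, ∃ t₀ : 𝒢.Ge e, (Subgroup.zpowers t₀).topologicalClosure = ⊤)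
    (C : Subgroup (𝒢.temperedPiChart h37.toProp36Hypotheses).G) (hC : C ≠ ⊥)
    (x x' : ∀ n, ((𝒢.galoisLevelData h37.toProp36Hypotheses).tree n).Vertex)
    (hx : ∀ ⦃i n : ℕ⦄ (hin : i ≤ n),
      ((𝒢.galoisLevelData h37.toProp36Hypotheses).treeTrans hin).vertexMap (x n) = x i)
    (hx' : ∀ ⦃i n : ℕ⦄ (hin : i ≤ n),
      ((𝒢.galoisLevelData h37.toProp36Hypotheses).treeTrans hin).vertexMap (x' n) = x' i)
    (hfx : ∀ g ∈ C, ∀ n, ((𝒢.galoisLevelData h37.toProp36Hypotheses).treeAct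
      h37.toProp36Hypotheses.isCountable n g).hom.vertexMap (x n) = x n)
    (hfx' : ∀ g ∈ C, ∀ n, ((𝒢.galoisLevelData h37.toProp36Hypotheses).treeAct
      h37.toProp36Hypotheses.isCountable n g).hom.vertexMap (x' n) = x' n) (j : ℕ) :
    ((𝒢.galoisLevelData h37.toProp36Hypotheses).tree j).subdivision.dist (Sum.inl (x j)) (Sum.inl (x' j)) ≤ 4 := by
  classical
  let D := 𝒢.galoisLevelData h37.toProp36Hypotheses
  let hc := h37.toProp36Hypotheses.isCountable
  by_cases hne : x j = x' j
  · rw [hne, SimpleGraph.dist_self]; exact Nat.zero_le _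
  -- the two systems differ from level `j` on
  have hne' : ∀ n, j ≤ n → x n ≠ x' n := fun n hn h => hne (by rw [← hx hn, ← hx' hn, h])
  -- a point sequence through `x`, over the base vertex `v`
  obtain ⟨v, T, hT⟩ := D.exists_pointSeq_vertex_eq hc x hx
  have hfT : ∀ g ∈ C, ∀ n, (D.treeAct hc n g).hom.vertexMap (T.vertex n) = T.vertex n := by
    intro g hg n; rw [hT n]; exact hfx g hg n
  -- a non-trivial element of `C`, non-trivial at some level
  obtain ⟨c₁, hc₁C, hc₁1⟩ : ∃ c ∈ C, c ≠ 1 := by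
    by_contra h
    push Not at h
    exact hC ((Subgroup.eq_bot_iff_forall C).2 h)
  obtain ⟨j₀, hj₀⟩ := 𝒢.exists_proj_ne_one h37.toProp36Hypotheses c₁ hc₁1
  -- the first branches `β n` of the geodesics `[x_n, x'_n]`, `n ≥ j`
  have hfirst : ∀ n, j ≤ n → ∃ (β : (D.tree n).Branch)
      (p : (D.tree n).subdivision.Walk (Sum.inl (T.vertex n)) (Sum.inl (x' n))),
      p.IsPath ∧ p.getVert 1 = Sum.inr (Sum.inr β) ∧ (D.tree n).abuts β = some (T.vertex n) ∧
      ∀ g ∈ C, (D.treeAct hc n g).hom.edgeMap ((D.tree n).edgeOf β) = (D.tree n).edgeOf β := by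
    intro n hn
    have hTn := (D.isTree_tree n).isTree
    let q : (D.tree n).subdivision.Path (Sum.inl (T.vertex n)) (Sum.inl (x' n)) :=
      (hTn.connected _ _).some.toPath
    have hlen : 0 < q.1.length := by
      rcases Nat.eq_zero_or_pos q.1.length with h | h
      · exfalso
        have h0 := SimpleGraph.Walk.eq_of_length_eq_zero h
        exact hne' n hn (by rw [← hT n]; exact Sum.inl_injective h0)
      · exact h
    have h01 := q.1.adj_getVert_succ (i := 0) hlen
    rw [SimpleGraph.Walk.getVert_zero, Nat.zero_add] at h01
    obtain ⟨β, hβa, hq1⟩ := ((D.tree n).subdivision_adj_inl_iff _ _).mp h01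
    have hqfix : ∀ z ∈ q.1.support, ∀ g ∈ C, SemiGraph.nodeMap (D.treeAct hc n g) z = z := by
      intro z hz g hg
      have hv₁ : (D.treeAct hc n g).hom.vertexMap (T.vertex n) = T.vertex n := hfT g hg n
      have hv₂ : (D.treeAct hc n g).hom.vertexMap (x' n) = x' n := hfx' g hg n
      have h1 : SemiGraph.nodeMap (D.treeAct hc n g) (Sum.inl (T.vertex n)) = Sum.inl (T.vertex n) := by
        simp [hv₁]
      have h2 : SemiGraph.nodeMap (D.treeAct hc n g) (Sum.inl (x' n)) = Sum.inl (x' n) := by simp [hv₂]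
      exact SemiGraph.nodeMap_eq_self_of_isPath hTn.isAcyclic _ h1 h2 q.1 q.2 z hz
    refine ⟨β, q.1, q.2, hq1, hβa, fun g hg => ?_⟩
    have hmem : (Sum.inr (Sum.inr β) : (D.tree n).Node) ∈ q.1.support := by
      rw [← hq1]; exact q.1.getVert_mem_support 1
    have h := hqfix _ hmem g hg
    simp only [SemiGraph.nodeMap_inr_inr, Sum.inr.injEq] at h
    rw [← (D.treeAct hc n g).hom.edgeOf_branchMap β, h]
  choose β p hp hp1 hβa hβfix using hfirst
  -- their base branches abut to `v`
  have hβv : ∀ n (hn : j ≤ n), 𝒢.graph.abuts ((D.treeProj n).branchMap (β n hn)) = some v := by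
    intro n hn
    rw [(D.treeProj n).abuts_branchMap _ _ (hβa n hn), T.treeProj_vertexMap_vertex]
  -- transported copies: at every deeper level `N`, `x_N` carries a `C`-fixed branch with image `β n`
  have htrans : ∀ n (hn : j ≤ n) N (hnN : n ≤ N), ∃ α : (D.tree N).Branch,
      (D.tree N).abuts α = some (T.vertex N) ∧ (D.treeTrans hnN).branchMap α = β n hn ∧
      ∀ g ∈ C, (D.treeAct hc N g).hom.edgeMap ((D.tree N).edgeOf α) = (D.tree N).edgeOf α :=
    fun n hn N hnN => 𝒢.exists_fixed_branch_at_host_of_firstBranch h37 hcyc C T hfT x' hx' hfx' (p n hn)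
      (hp n hn) (hp1 n hn) hnN
  -- (1) the first branches lie over ONE base branch (estrangement in depth at the host `x`)
  have hcb : ∀ n (hn : j ≤ n),
      (D.treeProj n).branchMap (β n hn) = (D.treeProj j).branchMap (β j le_rfl) := by
    intro n hn
    by_contra hneq
    obtain ⟨K, -, hK⟩ := 𝒢.eventually_not_fixed_pair_of_ne_base_pair h37 c₁ j₀ hj₀ v (hβv j le_rfl) (hβv n hn)
      (Ne.symm hneq)
    have hjN : j ≤ max n K := hn.trans (le_max_left n K)
    obtain ⟨α₁, hα₁a, hα₁i, hα₁f⟩ := htrans j le_rfl (max n K) hjN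
    obtain ⟨α₂, hα₂a, hα₂i, hα₂f⟩ := htrans n hn (max n K) (le_max_left n K)
    have h₁ : (D.treeProj (max n K)).branchMap α₁ = (D.treeProj j).branchMap (β j le_rfl) := by
      rw [D.treeProj_branchMap_eq_treeProj_treeTrans hjN, hα₁i]
    have h₂ : (D.treeProj (max n K)).branchMap α₂ = (D.treeProj n).branchMap (β n hn) := by
      rw [D.treeProj_branchMap_eq_treeProj_treeTrans (le_max_left n K), hα₂i]
    exact hK (max n K) (le_max_right n K) T α₁ α₂ h₁ h₂ hα₁a hα₂a (hα₁f c₁ hc₁C) (hα₂f c₁ hc₁C)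
  -- (2) eventual compatibility (the same-branch fold at the host `x`)
  have hfold : ∀ m (hm : j ≤ m), ∃ K, m ≤ K ∧ ∀ L (hKL : K ≤ L) (hmL : m ≤ L),
      (D.treeTrans hmL).branchMap (β L (hm.trans hmL)) = β m hm := by
    intro m hm
    obtain ⟨K, -, hmK, hK⟩ := 𝒢.eventually_fold_same_base_pair h37 c₁ j₀ hj₀ v (hβv j le_rfl) m
    refine ⟨K, hmK, fun L hKL hmL => ?_⟩
    obtain ⟨α, hαa, hαi, hαf⟩ := htrans m hm L hmL
    have hαb : (D.treeProj L).branchMap α = (D.treeProj j).branchMap (β j le_rfl) := by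
      rw [D.treeProj_branchMap_eq_treeProj_treeTrans hmL, hαi, hcb m hm]
    have h := hK L hKL T (β L (hm.trans hmL)) α (hcb L (hm.trans hmL)) hαb (hβa L _) hαa
      (hβfix L _ c₁ hc₁C) (hαf c₁ hc₁C) hmL
    rw [h, hαi]
  -- (3) full compatibility of the first branches
  have hcompat : ∀ i n (hi : j ≤ i) (hin : i ≤ n),
      (D.treeTrans hin).branchMap (β n (hi.trans hin)) = β i hi := by
    intro i n hi hin
    obtain ⟨K₁, hiK₁, hK₁⟩ := hfold i hi
    obtain ⟨K₂, hnK₂, hK₂⟩ := hfold n (hi.trans hin)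
    have hiL : i ≤ max K₁ K₂ := hiK₁.trans (le_max_left _ _)
    have hnL : n ≤ max K₁ K₂ := hnK₂.trans (le_max_right _ _)
    have h₁ := hK₁ (max K₁ K₂) (le_max_left _ _) hiL
    have h₂ := hK₂ (max K₁ K₂) (le_max_right _ _) hnL
    rw [← h₂, D.treeTrans_branchMap_comp hin hnL, ← h₁]
  -- (4) the eventual edge system of the first branches and its edge-point sequence
  let ε : ∀ n : {n : ℕ // j ≤ n}, (D.tree n.1).Edge := fun n => (D.tree n.1).edgeOf (β n.1 n.2)
  have hε : ∀ ⦃i n : {n : ℕ // j ≤ n}⦄ (h : i.1 ≤ n.1), (D.treeTrans h).edgeMap (ε n) = ε i := by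
    intro i n h
    change (D.treeTrans h).edgeMap ((D.tree n.1).edgeOf (β n.1 n.2)) = (D.tree i.1).edgeOf (β i.1 i.2)
    rw [← (D.treeTrans h).edgeOf_branchMap, hcompat i.1 n.1 i.2 h]
  obtain ⟨e, Q, hQε⟩ := GaloisLevelData.exists_edgeSeq_edge_eq_eventual (D := D) hc j ε hε
  have hQj : ∀ n (hn : j ≤ n), Q.edge n = (D.tree n).edgeOf (β n hn) := fun n hn => hQε ⟨n, hn⟩
  have hQ : ∀ g ∈ C, ∀ n, (D.treeAct hc n g).hom.edgeMap (Q.edge n) = Q.edge n := by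
    intro g hg n
    rcases le_or_gt j n with hn | hn
    · rw [hQj n hn]; exact hβfix n hn g hg
    · rw [← Q.treeTrans_edge (le_of_lt hn), ← D.treeTrans_act_edgeMap hc, hQj j le_rfl, hβfix j le_rfl g hg]
  -- (5) the two base branches of `e`: the one of `β j` at `v`, and the one beyond the point of `e`
  have hb₁e : 𝒢.graph.edgeOf ((D.treeProj j).branchMap (β j le_rfl)) = e := by
    rw [(D.treeProj j).edgeOf_branchMap, ← hQj j le_rfl, Q.treeProj_edgeMap_edge]
  have hinj := (hp j le_rfl).getVert_injOn
  have hend : (p j le_rfl).getVert (p j le_rfl).length = Sum.inl (x' j) := (p j le_rfl).getVert_length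
  have hlen2 : 2 ≤ (p j le_rfl).length := by
    by_contra h
    have h1 := (p j le_rfl).getVert_of_length_le (i := 1) (by omega)
    rw [hp1 j le_rfl] at h1
    simp at h1
  have h12 := (p j le_rfl).adj_getVert_succ (i := 1) (by omega)
  rw [hp1 j le_rfl] at h12
  have hp2 : (p j le_rfl).getVert 2 = Sum.inr (Sum.inl ((D.tree j).edgeOf (β j le_rfl))) := by
    rcases ((D.tree j).subdivision_adj_branch_iff _ _).mp h12 with h | ⟨u, hu, h⟩
    · exact h
    · exfalso
      rw [hβa j le_rfl] at hu; cases hu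
      have h0 : (p j le_rfl).getVert (1 + 1) = (p j le_rfl).getVert 0 := by
        rw [h, SimpleGraph.Walk.getVert_zero]
      have := hinj (by simp; omega) (by simp) h0
      omega
  have hlen3 : 3 ≤ (p j le_rfl).length := by
    by_contra h
    have h2 : (p j le_rfl).length = 2 := by omega
    rw [h2] at hend; rw [hend] at hp2; simp at hp2
  have h23 := (p j le_rfl).adj_getVert_succ (i := 2) (by omega)
  rw [hp2] at h23
  obtain ⟨β₃, hβ₃e, hp3⟩ := ((D.tree j).subdivision_adj_edge_iff _ _).mp h23
  have hβ₃ne : β₃ ≠ β j le_rfl := by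
    intro h
    rw [h] at hp3
    have h0 : (p j le_rfl).getVert (2 + 1) = (p j le_rfl).getVert 1 := by rw [hp3, hp1 j le_rfl]
    have := hinj (by simp; omega) (by simp; omega) h0
    omega
  have hlen4 : 4 ≤ (p j le_rfl).length := by
    by_contra h
    have h3 : (p j le_rfl).length = 3 := by omega
    rw [h3] at hend; rw [hend] at hp3; simp at hp3
  have h34 := (p j le_rfl).adj_getVert_succ (i := 3) (by omega)
  rw [hp3] at h34
  obtain ⟨u, hu⟩ : ∃ u, (D.tree j).abuts β₃ = some u := by
    rcases ((D.tree j).subdivision_adj_branch_iff β₃ _).mp h34 with h | ⟨u, hu, -⟩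
    · exfalso
      rw [hβ₃e] at h
      have h0 : (p j le_rfl).getVert (3 + 1) = (p j le_rfl).getVert 2 := by rw [h, hp2]
      have := hinj (by simp; omega) (by simp; omega) h0
      omega
    · exact ⟨u, hu⟩
  have hb₂ : 𝒢.graph.abuts ((D.treeProj j).branchMap β₃) = some ((D.treeProj j).vertexMap u) :=
    (D.treeProj j).abuts_branchMap β₃ u hu
  have hb₂e : 𝒢.graph.edgeOf ((D.treeProj j).branchMap β₃) = e := by
    rw [(D.treeProj j).edgeOf_branchMap, hβ₃e, ← hQj j le_rfl, Q.treeProj_edgeMap_edge]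
  have hb12 : (D.treeProj j).branchMap (β j le_rfl) ≠ (D.treeProj j).branchMap β₃ := fun h =>
    hβ₃ne ((D.treeProj j).branchMap_injOn _ _ hβ₃e h.symm)
  -- (6) the two-point fixed locus of the prequel
  exact 𝒢.dist_le_four_of_fixed_pair h37 hcyc C hC Q hQ hb12 hb₁e hb₂e (hβv j le_rfl) hb₂ x x' hx hx'
    hfx hfx' j

/-- **The binder `hbdd` (bound `4`) at the canonical tower of a `𝒢` with topologically cyclic edge groups,
any underlying graph**, in the shape consumed by the cell's assembly lemmas.
[cite: MochizukiSemiAnbd2006, Thm 3.7(iii) p.41] -/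
theorem hbdd_temperedPiChart_of_topCyclic
    (hcyc : ∀ e : 𝒢.graph.Edge, ∃ t₀ : 𝒢.Ge e, (Subgroup.zpowers t₀).topologicalClosure = ⊤)
    (C : Subgroup (𝒢.temperedPiChart h37.toProp36Hypotheses).G) (hC : C ≠ ⊥)
    (x x' : ∀ j, ((verticialLevelData_temperedPiChart (h36 := h37.toProp36Hypotheses)).tree j).Vertex)
    (hx : ∀ ⦃i j : ℕ⦄ (hij : i ≤ j),
      ((verticialLevelData_temperedPiChart (h36 := h37.toProp36Hypotheses)).trans hij).vertexMap (x j) = x i)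
    (hx' : ∀ ⦃i j : ℕ⦄ (hij : i ≤ j),
      ((verticialLevelData_temperedPiChart (h36 := h37.toProp36Hypotheses)).trans hij).vertexMap (x' j) = x' i)
    (hfx : ∀ g ∈ C, ∀ j,
      ((verticialLevelData_temperedPiChart (h36 := h37.toProp36Hypotheses)).act j g).hom.vertexMap (x j) = x j)
    (hfx' : ∀ g ∈ C, ∀ j,
      ((verticialLevelData_temperedPiChart (h36 := h37.toProp36Hypotheses)).act j g).hom.vertexMap (x' j) = x' j) :
    ∃ N : ℕ, ∀ j, ((verticialLevelData_temperedPiChart (h36 := h37.toProp36Hypotheses)).tree j).subdivision.dist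
      (Sum.inl (x j)) (Sum.inl (x' j)) ≤ N :=
  ⟨4, fun j => 𝒢.dist_le_four_of_fixed_of_topCyclic h37 hcyc C hC x x' hx hx' hfx hfx' j⟩

/-- **(FIX∞).`hadj` at the canonical tower of a `𝒢` with topologically cyclic edge groups, any underlying
graph** (abc-iut-L3-t10's `hadj_temperedPiChart_of_bounded_dist'` with its bound supplied by
`hbdd_temperedPiChart_of_topCyclic`): two compatible vertex systems fixed by a compact `C ≠ 1` are, at every
level where they differ, the two ends of a `C`-fixed edge. [cite: MochizukiSemiAnbd2006, Thm 3.7(iii) p.41] -/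
theorem hadj_temperedPiChart_of_topCyclic
    (hcyc : ∀ e : 𝒢.graph.Edge, ∃ t₀ : 𝒢.Ge e, (Subgroup.zpowers t₀).topologicalClosure = ⊤)
    (C : Subgroup (𝒢.temperedPiChart h37.toProp36Hypotheses).G)
    (hCc : IsCompact (C : Set (𝒢.temperedPiChart h37.toProp36Hypotheses).G)) (hC : C ≠ ⊥)
    (x x' : ∀ j, ((verticialLevelData_temperedPiChart (h36 := h37.toProp36Hypotheses)).tree j).Vertex)
    (hx : ∀ ⦃i j : ℕ⦄ (hij : i ≤ j),
      ((verticialLevelData_temperedPiChart (h36 := h37.toProp36Hypotheses)).trans hij).vertexMap (x j) = x i)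
    (hx' : ∀ ⦃i j : ℕ⦄ (hij : i ≤ j),
      ((verticialLevelData_temperedPiChart (h36 := h37.toProp36Hypotheses)).trans hij).vertexMap (x' j) = x' i)
    (hfx : ∀ g ∈ C, ∀ j,
      ((verticialLevelData_temperedPiChart (h36 := h37.toProp36Hypotheses)).act j g).hom.vertexMap (x j) = x j)
    (hfx' : ∀ g ∈ C, ∀ j,
      ((verticialLevelData_temperedPiChart (h36 := h37.toProp36Hypotheses)).act j g).hom.vertexMap (x' j) = x' j)
    (j : ℕ) (hne : x j ≠ x' j) :
    ∃ (e : ((verticialLevelData_temperedPiChart (h36 := h37.toProp36Hypotheses)).tree j).Edge)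
      (b b' : ((verticialLevelData_temperedPiChart (h36 := h37.toProp36Hypotheses)).tree j).Branch), b ≠ b' ∧
      ((verticialLevelData_temperedPiChart (h36 := h37.toProp36Hypotheses)).tree j).edgeOf b = e ∧
      ((verticialLevelData_temperedPiChart (h36 := h37.toProp36Hypotheses)).tree j).edgeOf b' = e ∧
      ((verticialLevelData_temperedPiChart (h36 := h37.toProp36Hypotheses)).tree j).abuts b = some (x j) ∧
      ((verticialLevelData_temperedPiChart (h36 := h37.toProp36Hypotheses)).tree j).abuts b' = some (x' j) ∧
      ∀ g ∈ C, ((verticialLevelData_temperedPiChart (h36 := h37.toProp36Hypotheses)).act j g).hom.edgeMap e = e :=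
  hadj_temperedPiChart_of_bounded_dist' h37 C hCc hC x x' hx hx' hfx hfx'
    (𝒢.hbdd_temperedPiChart_of_topCyclic h37 hcyc C hC x x' hx hx' hfx hfx') j hne

/-- **The centraliser of EVERY nontrivial compact subgroup lies in each of its verticial hosts — topologically
cyclic edge groups, ANY underlying graph** (canonical chart; host-free form of the prequel's
`centralizer_le_verticial_of_topCyclic`): for `C` compact `≠ 1` and `H ⊇ C` verticial, `centralizer C ≤ H`
(`hbdd_temperedPiChart_of_topCyclic` for the pair `(y, g·y)`, then abc-iut-f-172 gen 4's
`mem_verticial_of_centralizer_of_bounded_displacement`). [cite: MochizukiSemiAnbd2006, Thm 3.7(iii) pp.40-41] -/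
theorem centralizer_le_verticial_of_compact_of_topCyclic
    (hcyc : ∀ e : 𝒢.graph.Edge, ∃ t₀ : 𝒢.Ge e, (Subgroup.zpowers t₀).topologicalClosure = ⊤)
    (C : Subgroup (𝒢.temperedPiChart h37.toProp36Hypotheses).G)
    (hCc : IsCompact (C : Set (𝒢.temperedPiChart h37.toProp36Hypotheses).G)) (hC : C ≠ ⊥)
    {v : 𝒢.graph.Vertex} {H : Subgroup (𝒢.temperedPiChart h37.toProp36Hypotheses).G}
    (hH : H ∈ verticialSubgroups (𝒢.temperedPiChart h37.toProp36Hypotheses) v) (hCH : C ≤ H) :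
    Subgroup.centralizer (C : Set (𝒢.temperedPiChart h37.toProp36Hypotheses).G) ≤ H := by
  intro g hg
  obtain ⟨y, hyc, hyH⟩ := 𝒢.exists_fixed_system_of_mem_verticialSubgroups h37 hH
  have hcomm : ∀ k ∈ C, k * g = g * k := fun k hk => Subgroup.mem_centralizer_iff.mp hg k hk
  have hyC : ∀ k ∈ C, ∀ j,
      ((verticialLevelData_temperedPiChart (h36 := h37.toProp36Hypotheses)).act j k).hom.vertexMap (y j) =
        y j := fun k hk j => hyH k (hCH hk) j
  have hy₁c := (verticialLevelData_temperedPiChart (h36 := h37.toProp36Hypotheses)).translate_compat' g hyc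
  have hy₁C := (verticialLevelData_temperedPiChart (h36 := h37.toProp36Hypotheses)).translate_fixed' hcomm hyC
  exact 𝒢.mem_verticial_of_centralizer_of_bounded_displacement h37 C hCc hC hH hCH y hyc hyH g hg
    (𝒢.hbdd_temperedPiChart_of_topCyclic h37 hcyc C hC y
      (fun j => ((verticialLevelData_temperedPiChart (h36 := h37.toProp36Hypotheses)).act j g).hom.vertexMap
        (y j)) hyc hy₁c hyC hy₁C)

end ProfiniteSemiGraph

end Literature.AnabelianGeometry.SemiGraphs
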